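import Summits.ResolutionOfSingularities.ResolutionOfSingularities.Theorems.WildQuotientsSummitReductionStubPairOrbitBlowupCentreLocalLemmas
import Summits.ResolutionOfSingularities.ResolutionOfSingularities.Theorems.WildQuotientsSummitReductionStubPairOrbitNormalFormBlowupChartsOverCentreCharts
import Literature.AlgebraicGeometry.Resolution.AlterationsNormalFormBlowupFormalProofs
import Literature.AlgebraicGeometry.Resolution.StalkIdealLemmas
import Literature.AlgebraicGeometry.Resolution.IdealSheafLemmas
import HarnessLib

/-!
# `WildQuotients.SummitReduction` (stmt-ResolutionOfSingularities-16324), line `FramePerfect`, stub NB2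
# (`stub_pair_orbitNormalFormBlowup_modelChartsOverCentre`): the local rings of the blown-up model and
# the dictionary of stalk ideals

Route `ResolutionOfSingularities/WildQuotients`, crux `SummitReduction`; helper file of stub NB2 =
de Jong 1996, 4.27 [C2] on the coefficient-free model `M = A⟦u, v⟧/(uv - ∏_{i<s} tᵢ)`, where the
blow-up `ρ₁ : B → Spec M` in the centre `(u, v, t_a, t_b)` is only given up to the universal property
(`IsBlowup`). This file is the scheme-to-algebra bridge (the steps "M3" and "M3b" of the line's
plan): PROVED here

* `modelChartsOverCentre_blowup_stalk_chart` — a point `y` of a blow-up of `Spec R` along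
  `(g₁, …, g_n)` lies on the chart `Spec R[I/g_j]` of some `g_j` (`IsBlowup.exists_chart_of_span_range_eq`,
  Stacks 0804), its local ring is `R[I/g_j]_𝔮` (maximal `𝔮` for closed `y`), and for EVERY ideal
  `K ⊆ R` the stalk at `y` of the inverse image ideal sheaf of `K` goes to `K · R[I/g_j]_𝔮`
  (`stalkIdeal_comap_eq_map_stalkMap`, `comap_ofIdealTop_SpecMap`, `Spec.germ_stalkMapIso_hom`);
* `modelChartsOverCentre_exists_localization_quotient_equiv` (and `…_of_quotient_equiv`) —
  `(C/(f))_𝔮 ≅ L/(f) L` for a localisation `L` of `C` at the preimage of `𝔮`, compatibly with the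
  structure maps;
* `modelChartsOverCentre_model_stalk` — for the hypersurface `Spec P/(F)`, `F = c₀c₁ - c₂c₃H` with
  `(c, w)` a regular system of parameters of the regular local ring `P` and the centre `𝔓 = (c)`, at
  a CLOSED point `y` over the closed point: `𝒪_{B,y} ≅ L/(f)` with `L` a localisation of the chart
  `P[𝔓/c_j]` at a maximal ideal `𝔔 ∋ f` over `𝔪_P` and `f` the strict transform (`F = c_j² f`,
  `chartsOverCentre_exists_strictTransform_equiv`), the stalk ideal of the inverse image of `K̄`
  going to `K · L/(f)` for every ideal `K ⊆ P` (de Jong 1996, 4.27: "We get four charts: "`u ≠ 0`",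
  "`v ≠ 0`", "`t₁ ≠ 0`" and "`t₂ ≠ 0`"").

## Sources

* A. J. de Jong, *Smoothness, semi-stability and alterations*, Publ. Math. IHÉS 83 (1996), 4.27,
  pp. 75–76. [DeJong1996]
* The Stacks Project, Tag 0804 (charts of a blowing up). [StacksProject]
-/

set_option linter.dupNamespace false -- the tree's summit namespace repeats `ResolutionOfSingularities`

noncomputable section

open CategoryTheory CategoryTheory.Limits AlgebraicGeometry TopologicalSpace
open IsLocalRing
open Literature.AlgebraicGeometry.Resolution

namespace Summit.ResolutionOfSingularities.ResolutionOfSingularities.Theorems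

/-- The stalk at `x` of the ideal sheaf on `Spec R` of an ideal `J ⊆ R`, pushed to the
localisation `R_x` along Mathlib's `Spec.stalkIso`, is the extension `J R_x`. [folklore] -/
theorem modelChartsOverCentre_stalkIdeal_ofIdealTop_map_stalkIso {R : Type} [CommRing R]
    (J : Ideal R) (x : Spec (.of R)) :
    (stalkIdeal (Scheme.IdealSheafData.ofIdealTop
        (J.map (Scheme.ΓSpecIso (.of R)).inv.hom) : (Spec (.of R)).IdealSheafData) x).map
        (Spec.stalkIso (.of R) x).hom.hom =
      J.map (algebraMap R (Localization.AtPrime x.asIdeal)) := by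
  rw [stalkIdeal_eq_map_germ _ ⟨⊤, isAffineOpen_top _⟩ (Set.mem_univ x), ideal_ofIdealTop_top,
    Ideal.map_map, Ideal.map_map]
  congr 1
  change ((Spec.stalkIso (.of R) x).hom.hom.comp ((Spec (.of R)).presheaf.germ ⊤ x trivial).hom).comp _ = _
  rw [← CommRingCat.hom_comp, Spec.germ_stalkMapIso_hom (R := .of R) x, CommRingCat.hom_comp,
    CommRingCat.hom_ofHom, RingHom.comp_assoc, ← CommRingCat.hom_comp, Iso.inv_hom_id,
    CommRingCat.hom_id, RingHom.comp_id]

/-- **The local rings of a blow-up of `Spec R` along `(g)` and the stalk ideals of the inverse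
image ideal sheaves**: a point `y` lies on the chart `Spec R[I/g_j]` of some `g_j`; its local
ring is the localisation of `R[I/g_j]` at a prime `𝔮` (maximal if `y` is closed), the point
`ρ₁ y` is the contraction of `𝔮` to `R`, and for every ideal `K ⊆ R` the stalk at `y` of the
inverse image of the ideal sheaf of `K` is carried to `K · R[I/g_j]_𝔮`.
[cite: StacksProject, Tag 0804] -/
theorem modelChartsOverCentre_blowup_stalk_chart {R : Type} [CommRing R] {I : Ideal R} {κ : Type}
    (g : κ → R) (hg : Ideal.span (Set.range g) = I)
    {B : Scheme.{0}} (ρ₁ : B ⟶ Spec (.of R))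
    (hB : IsBlowup ρ₁ (Scheme.IdealSheafData.ofIdealTop (I.map (Scheme.ΓSpecIso (.of R)).inv.hom)))
    (y : B) :
    ∃ (j : κ) (z : Spec (.of (blowupAlgebra I (g j))))
      (Θ : B.presheaf.stalk y ≃+* Localization.AtPrime z.asIdeal),
      (IsClosed ({y} : Set B) → z.asIdeal.IsMaximal) ∧
      (ρ₁.base y).asIdeal = z.asIdeal.comap (algebraMap R (blowupAlgebra I (g j))) ∧
      ∀ K : Ideal R,
        (stalkIdeal ((Scheme.IdealSheafData.ofIdealTop
          (K.map (Scheme.ΓSpecIso (.of R)).inv.hom)).comap ρ₁) y).map Θ.toRingHom =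
        (K.map (algebraMap R (blowupAlgebra I (g j)))).map
          (algebraMap (blowupAlgebra I (g j)) (Localization.AtPrime z.asIdeal)) := by
  obtain ⟨j, φ, _, ⟨z, rfl⟩, hφ⟩ := hB.exists_chart_of_span_range_eq g hg y
  let Θ₀ : B.presheaf.stalk (φ.base z) ≃+* (Spec (.of (blowupAlgebra I (g j)))).presheaf.stalk z :=
    (asIso (φ.stalkMap z)).commRingCatIsoToRingEquiv
  let Θ₁ : (Spec (.of (blowupAlgebra I (g j)))).presheaf.stalk z ≃+* Localization.AtPrime z.asIdeal :=
    (Spec.stalkIso (.of (blowupAlgebra I (g j))) z).commRingCatIsoToRingEquiv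
  refine ⟨j, z, Θ₀.trans Θ₁, fun hyc => ?_, ?_, fun K => ?_⟩
  · have hzc : IsClosed ({z} : Set _) := by
      have : ({z} : Set _) = φ.base ⁻¹' {φ.base z} := by
        ext z'
        simp only [Set.mem_singleton_iff, Set.mem_preimage]
        exact ⟨fun h => by rw [h], fun h => φ.isOpenEmbedding.injective h⟩
      rw [this]
      exact hyc.preimage φ.continuous
    exact (PrimeSpectrum.isClosed_singleton_iff_isMaximal z).mp hzc
  · rw [← Scheme.Hom.comp_apply, hφ]
    rfl
  · rw [RingEquiv.toRingHom_eq_coe, RingEquiv.coe_ringHom_trans, ← Ideal.map_map]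
    have h1 : (stalkIdeal ((Scheme.IdealSheafData.ofIdealTop
        (K.map (Scheme.ΓSpecIso (.of R)).inv.hom)).comap ρ₁) (φ.base z)).map (Θ₀ : _ →+* _) =
        stalkIdeal (Scheme.IdealSheafData.ofIdealTop
          ((K.map (algebraMap R (blowupAlgebra I (g j)))).map
            (Scheme.ΓSpecIso (.of (blowupAlgebra I (g j)))).inv.hom)) z := by
      rw [← comap_ofIdealTop_SpecMap, ← hφ, Scheme.IdealSheafData.comap_comp,
        stalkIdeal_comap_eq_map_stalkMap φ]
      rfl
    rw [h1]
    exact modelChartsOverCentre_stalkIdeal_ofIdealTop_map_stalkIso _ z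

/-- **`(C/(f))_𝔮 ≅ L/(f) L` for a localisation `L` of `C` at the preimage of `𝔮`**, compatibly
with `C → C/(f)` and `C → L`. [folklore] -/
theorem modelChartsOverCentre_exists_localization_quotient_equiv {C : Type} [CommRing C] (f : C)
    (P : Ideal (C ⧸ Ideal.span {f})) [P.IsPrime]
    (L : Type) [CommRing L] [Algebra C L]
    [IsLocalization.AtPrime L (P.comap (Ideal.Quotient.mk (Ideal.span {f})))] :
    ∃ e : Localization.AtPrime P ≃+* L ⧸ Ideal.span {algebraMap C L f},
      ∀ c : C, e (algebraMap _ (Localization.AtPrime P) (Ideal.Quotient.mk (Ideal.span {f}) c)) =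
        Ideal.Quotient.mk (Ideal.span {algebraMap C L f}) (algebraMap C L c) := by
  have hsub : Algebra.algebraMapSubmonoid (C ⧸ Ideal.span {f})
      (P.comap (Ideal.Quotient.mk (Ideal.span {f}))).primeCompl = P.primeCompl := by
    ext x
    constructor
    · rintro ⟨c, hc, rfl⟩
      exact hc
    · intro hx
      obtain ⟨c, rfl⟩ := Ideal.Quotient.mk_surjective x
      exact ⟨c, hx, rfl⟩
  haveI : IsLocalization P.primeCompl (L ⧸ (Ideal.span {f}).map (algebraMap C L)) := by
    rw [← hsub]
    infer_instance
  have hmap : (Ideal.span {f}).map (algebraMap C L) = Ideal.span {algebraMap C L f} := by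
    rw [Ideal.map_span, Set.image_singleton]
  refine ⟨(IsLocalization.algEquiv P.primeCompl (Localization.AtPrime P)
    (L ⧸ (Ideal.span {f}).map (algebraMap C L))).toRingEquiv.trans (Ideal.quotEquivOfEq hmap),
    fun c => ?_⟩
  change Ideal.quotEquivOfEq hmap (IsLocalization.algEquiv P.primeCompl (Localization.AtPrime P)
    (L ⧸ (Ideal.span {f}).map (algebraMap C L)) (algebraMap _ _ (Ideal.Quotient.mk (Ideal.span {f}) c))) = _
  rw [AlgEquiv.commutes]
  rfl

/-- **Transport of a localisation along a ring isomorphism onto a quotient**: for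
`Ψ : C/(f) ≅ D` and a prime `𝔮` of `D`, `D_𝔮 ≅ L/(f) L` where `L` is a localisation of `C` at
the preimage of `𝔮`, compatibly with `C → C/(f) → D → D_𝔮` and `C → L → L/(f) L`. [folklore] -/
theorem modelChartsOverCentre_exists_localization_equiv_of_quotient_equiv {C D : Type} [CommRing C]
    [CommRing D] (f : C) (Ψ : (C ⧸ Ideal.span {f}) ≃+* D) (𝔮 : Ideal D) [𝔮.IsPrime]
    (L : Type) [CommRing L] [Algebra C L]
    [IsLocalization.AtPrime L ((𝔮.comap Ψ.toRingHom).comap (Ideal.Quotient.mk (Ideal.span {f})))] :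
    ∃ e : Localization.AtPrime 𝔮 ≃+* L ⧸ Ideal.span {algebraMap C L f},
      ∀ c : C, e (algebraMap D (Localization.AtPrime 𝔮) (Ψ (Ideal.Quotient.mk (Ideal.span {f}) c))) =
        Ideal.Quotient.mk (Ideal.span {algebraMap C L f}) (algebraMap C L c) := by
  obtain ⟨ε₃, hε₃⟩ := exists_localization_ringEquiv_of_ringEquiv Ψ 𝔮
  obtain ⟨e, he⟩ := modelChartsOverCentre_exists_localization_quotient_equiv f (𝔮.comap Ψ.toRingHom) L
  exact ⟨ε₃.trans e, fun c => by rw [RingEquiv.trans_apply, hε₃, he]⟩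

/-- In a local ring, a non-unit stays a non-unit modulo a proper principal ideal. [folklore] -/
theorem modelChartsOverCentre_not_isUnit_mk {P : Type} [CommRing P] [IsLocalRing P] {F p : P}
    (hF : F ∈ maximalIdeal P) (hp : p ∈ maximalIdeal P) :
    ¬ IsUnit (Ideal.Quotient.mk (Ideal.span {F}) p) := by
  intro hu
  obtain ⟨v, hv⟩ := hu.exists_right_inv
  obtain ⟨q, rfl⟩ := Ideal.Quotient.mk_surjective v
  rw [← map_mul, ← map_one (Ideal.Quotient.mk (Ideal.span {F})), Ideal.Quotient.mk_eq_mk_iff_sub_mem,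
    Ideal.mem_span_singleton'] at hv
  obtain ⟨a, ha⟩ := hv
  have h1 : (1 : P) = p * q - a * F := by rw [ha]; ring
  have : (1 : P) ∈ maximalIdeal P := by
    rw [h1]
    exact Ideal.sub_mem _ (Ideal.mul_mem_right _ _ hp) (Ideal.mul_mem_left _ _ hF)
  exact (maximalIdeal.isMaximal P).ne_top ((Ideal.eq_top_iff_one _).mpr this)

set_option maxHeartbeats 1000000 in
/-- **The local rings of a blow-up of the hypersurface `Spec P/(F)`, `F = c₀c₁ - c₂c₃H`, in
`𝔓̄ = (c̄)` at the closed points over the closed point, and their stalk ideals.** Such a point `y`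
lies on the chart of some `c_j`; its local ring is `L/(f)` for `L` the localisation of the chart
`P[𝔓/c_j]` of the blow-up of `Spec P` at a maximal ideal `𝔔 ∋ f` over `𝔪_P` and `f` the strict
transform (`F = c_j² f`; the chart of the blown-up hypersurface is `P[𝔓/c_j]/(f)`,
`chartsOverCentre_exists_strictTransform_equiv`), and for every ideal `K ⊆ P` the stalk at `y`
of the inverse image ideal sheaf of `K̄ ⊆ P/(F)` is carried to `K · L/(f)` — de Jong 1996, 4.27:
"We blow up … in the ideal `(u, v, t₁, t₂)`. We get four charts: "`u ≠ 0`", "`v ≠ 0`", "`t₁ ≠ 0`"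
and "`t₂ ≠ 0`"." [cite: DeJong1996, 4.27, p. 76] [cite: StacksProject, Tag 0804] -/
theorem modelChartsOverCentre_model_stalk {P : Type} [CommRing P] [IsRegularLocalRing P]
    (c : Fin 4 → P) {l : ℕ} (w : Fin l → P)
    (hz : Ideal.span (Set.range (Fin.append c w)) = maximalIdeal P)
    (hd : (maximalIdeal P).spanFinrank = 4 + l)
    (𝔓 : Ideal P) (h𝔓 : 𝔓 = Ideal.span (Set.range c)) (hc : ∀ k, c k ∈ 𝔓) (H F : P)
    (hF : F = c 0 * c 1 - c 2 * c 3 * H)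
    {B : Scheme.{0}} (ρ₁ : B ⟶ Spec (.of (P ⧸ Ideal.span {F})))
    (hB : IsBlowup ρ₁ (Scheme.IdealSheafData.ofIdealTop
      ((𝔓.map (Ideal.Quotient.mk (Ideal.span {F}))).map
        (Scheme.ΓSpecIso (.of (P ⧸ Ideal.span {F}))).inv.hom)))
    (y : B) (hyc : IsClosed ({y} : Set B)) (hy : ∀ a, a ∈ (ρ₁.base y).asIdeal ∨ IsUnit a) :
    ∃ (j : Fin 4) (g : P) (_ : c j = g) (𝔔 : Ideal (blowupAlgebra 𝔓 g)) (_ : 𝔔.IsMaximal),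
      𝔔.comap (algebraMap P (blowupAlgebra 𝔓 g)) = maximalIdeal P ∧
      ∀ (f : blowupAlgebra 𝔓 g),
        algebraMap P (blowupAlgebra 𝔓 g) F = algebraMap P (blowupAlgebra 𝔓 g) g ^ 2 * f →
        f ∈ 𝔔 ∧
        ∀ (L : Type) [CommRing L] [Algebra (blowupAlgebra 𝔓 g) L] [IsLocalization.AtPrime L 𝔔],
        ∃ Θ : B.presheaf.stalk y ≃+* L ⧸ Ideal.span {algebraMap (blowupAlgebra 𝔓 g) L f},
          ∀ K : Ideal P,
            (stalkIdeal ((Scheme.IdealSheafData.ofIdealTop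
              ((K.map (Ideal.Quotient.mk (Ideal.span {F}))).map
                (Scheme.ΓSpecIso (.of (P ⧸ Ideal.span {F}))).inv.hom)).comap ρ₁) y).map Θ.toRingHom =
            K.map ((Ideal.Quotient.mk (Ideal.span {algebraMap (blowupAlgebra 𝔓 g) L f})).comp
              ((algebraMap (blowupAlgebra 𝔓 g) L).comp (algebraMap P (blowupAlgebra 𝔓 g)))) := by
  classical
  have hg : Ideal.span (Set.range (fun k => Ideal.Quotient.mk (Ideal.span {F}) (c k))) =
      𝔓.map (Ideal.Quotient.mk (Ideal.span {F})) := by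
    rw [h𝔓, Ideal.map_span, ← Set.range_comp]
    rfl
  obtain ⟨j, z, Θ₀, hzmax, hρy, hdict⟩ :=
    modelChartsOverCentre_blowup_stalk_chart (fun k => Ideal.Quotient.mk (Ideal.span {F}) (c k)) hg ρ₁ hB y
  haveI := hzmax hyc
  obtain ⟨Ψ, hΨr, -⟩ := chartsOverCentre_exists_strictTransform_equiv c j w hz hd 𝔓 h𝔓 hc H F hF
  haveI h1 : (z.asIdeal.comap Ψ.toRingHom).IsMaximal := Ideal.comap_isMaximal_of_surjective _ Ψ.surjective
  haveI h2 : ((z.asIdeal.comap Ψ.toRingHom).comap (Ideal.Quotient.mk _)).IsMaximal :=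
    Ideal.comap_isMaximal_of_surjective _ Ideal.Quotient.mk_surjective
  refine ⟨j, c j, rfl, (z.asIdeal.comap Ψ.toRingHom).comap (Ideal.Quotient.mk _), h2, ?_, fun f hfF => ?_⟩
  · -- `𝔔` lies over `𝔪_P`
    have hF𝔪 : F ∈ maximalIdeal P := by
      have hck : ∀ k, c k ∈ maximalIdeal P := fun k =>
        hz ▸ Ideal.subset_span ⟨Fin.castAdd l k, Fin.append_left c w k⟩
      rw [hF]
      exact Ideal.sub_mem _ (Ideal.mul_mem_left _ _ (hck 1))
        (Ideal.mul_mem_right _ _ (Ideal.mul_mem_left _ _ (hck 3)))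
    symm
    refine (maximalIdeal.isMaximal P).eq_of_le (Ideal.comap_ne_top _ h2.ne_top) fun p hp => ?_
    have hmem : Ideal.Quotient.mk (Ideal.span {F}) p ∈ (ρ₁.base y).asIdeal :=
      (hy _).resolve_right (modelChartsOverCentre_not_isUnit_mk hF𝔪 hp)
    rw [hρy, Ideal.mem_comap, ← hΨr] at hmem
    rw [Ideal.mem_comap, Ideal.mem_comap]
    exact hmem
  -- `f` is the strict transform
  have hf₀ := chartsOverCentre_algebraMap_relation c 𝔓 hc j H
  rw [← hF, hfF] at hf₀
  have hfeq := (mul_cancel_left_mem_nonZeroDivisors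
    (pow_mem (algebraMap_mem_nonZeroDivisors_blowupAlgebra (I := 𝔓) (a := c j)) 2)).mp hf₀
  subst hfeq
  refine ⟨mem_comap_mk_span_singleton _ _, fun L _ _ _ => ?_⟩
  obtain ⟨e, he⟩ := modelChartsOverCentre_exists_localization_equiv_of_quotient_equiv _ Ψ z.asIdeal L
  refine ⟨Θ₀.trans e, fun K => ?_⟩
  -- the dictionary
  have hK := hdict (K.map (Ideal.Quotient.mk (Ideal.span {F})))
  rw [RingEquiv.toRingHom_eq_coe] at hK
  rw [RingEquiv.toRingHom_eq_coe, RingEquiv.coe_ringHom_trans, ← Ideal.map_map, hK, Ideal.map_map,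
    Ideal.map_map, Ideal.map_map]
  congr 1
  ext p
  simp only [RingHom.comp_apply, RingHom.coe_coe]
  rw [← hΨr, he]

end Summit.ResolutionOfSingularities.ResolutionOfSingularities.Theorems

end
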